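/-
Copyright (c) 2026 the pub-hodgecm-mathlib formalisation cell (harness21).  Prover seat hodgecm-mathlib-F0P3-p02 (g27); E1 keeper ∕ dealer F0P3a-p03 (g31) k107 (ROW 80 (X0));
EXT-ROAD v2 «12.6.1 (b)-REST VIA THE EP DEFECT + BLOCK SEPARATION» (censuses LH6-p04 (g12) 85875cce, F0P3a-p06 (g27) 4d08d059), step (S-A) «CROSS-TRACE-ZERO», FILE B (2026-09-03).
-/
import Summits.HodgeConjecture.HodgeConjecture.Theorems.F0P3cStCharTSEPNormOneOfHsplit     -- ★ row 73 (LH5-p02 g12) p853739: the §U∕§U′ construction this file twins; brings ★ 59-F `F0P3cStCharTSEPNormOneUnr`, ★ 58 FILE 1 S2a, ★ 41g-H, ★ (G3), ★ 43, ★ 39γ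
import Summits.HodgeConjecture.HodgeConjecture.Theorems.F0P3cStCharTSEPTracePairAtDatum     -- ROW 80 FILE A (this seat): §4 `innerG_char_eq_zero_of_forall_extension_split_of_isPseudoCoeff_epTwoFamilies` (two-family letters)
import HarnessLib

/-!
# F0 · P3c · «StCharTS» EXT-ROAD brick (X0), FILE B — CROSS-NORM-ZERO AT AN UNRAMIFIED PLACE: `⟨χ_{π′}, χ_π⟩_e = 0` for irreducible smooth `π = [r]`, `π′ = [r′]` of `U(Φ₃)(L⁺_v)`
# whenever every smooth extension of `π` by `π′` splits and `Hom_G(π, π′) = 0` — the CROSS twin of ★ row 73 `F0P3cStCharTSEPNormOneOfHsplit` §U∕§U′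

Cell `pub/hodgecm-mathlib` (D-0151), crux H413 = `stmt-HodgeConjecture-24833` (`--supports` lane, `--as helper`: THEOREMS ONLY — no definition ∕ instance ∕ notation ∕ named fact ∕
`sorry`; count-neutral: closes no node).  Namespace `Summit.HodgeConjecture.HodgeConjecture.Cruxes.H413.F0P3cStCharTSEPCrossNormZeroUnr`.  Seat F0P3-p02 (g27).

THE MATHEMATICS ([SchneiderStuhler1997, §III.4]; [Kottwitz1988, §2]; [Rogawski1990, §12.6 p. 187]).  For irreducible smooth `π = [r]`, `π′ = [r′]` of `G = U(Φ₃)(L⁺_v)` (`v` non-split,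
UNRAMIFIED in `L`) the Euler–Poincaré function `f_EP^π` of the Schneider–Stuhler resolution `0 → C₁(X)^π → C₀(X)^π → π → 0` is a pseudo-coefficient of `π` (★ row 58 S2a), so
`⟨χ_{π′}, χ_π⟩_e = tr π′(f_EP^π) = dim Hom_G(C₀^π, π′) − dim Hom_G(C₁^π, π′)` (★ PCT-OUT + FILE A); if every SMOOTH extension `0 → π′ → E → π → 0` splits, the forward count ★ (J′)
gives `dim Hom_G(C₀^π, π′) = dim Hom_G(π, π′) + dim Hom_G(C₁^π, π′)`, whence **`⟨χ_{π′}, χ_π⟩_e = dim Hom_G(π, π′) = 0`** for `π ≇ π′`.  EXT-ROAD v2 (S-A) reads it contrapositively: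
`⟨χ_{π′}, χ_π⟩_e ≠ 0 ∧ π ≠ π′ ⇒` a NON-SPLIT smooth extension of `π` by `π′` (then (SEP) ★ row 79 ∕ (X2) block separation).
The four layers are ★ 59-F `F0P3cStCharTSEPNormOneUnr` §1∕§2 and ★ 73 §U∕§U′ with `hsplit` (self-extensions) REPLACED by the cross letters `(r′) (hsplit₂) (hHom0)` and the trunk call
replaced by FILE A §4; every construction line is theirs VERBATIM.
* §1 `innerG_char_cross_eq_zero_of_isPseudoCoeff_epThree` — row 58's 3-TERM letters (`P₀ P₂ P₁`, `τ₀ τ₂ τ₁`, `f₀ f₂ f₁`, `hpc3`): orbit data based at `d₁` (★ `exists_vertexOrbitData_gqs`,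
  `ι₀ := Bool`; ★ `exists_edgeOrbitData_gqs`, `ι₁ := Unit`) ⇒ FILE A §4.
* §2 `innerG_char_cross_eq_zero_of_unramified_explicit_pieces` — §1 with `hpc3 := ★ S2a isPseudoCoeff_epFunction_of_unramified_explicit` (binders = S2a's VERBATIM + ★ PCT-OUT's five).
* §3 **`innerG_char_cross_eq_zero_of_unramified_explicit (hns) (w hw hd eA heA) … (r) (r′) (hsplit₂) (hHom0)`** — ★ 73 §U's construction VERBATIM (level by ★ 43 under the open stabiliser
  of a non-zero vector at the apartment vertex `A 0` ★ 39γ, tree letters ★ 41g-H §2, orientation, base edge `A 0 — A 1`, stabilisers through `eA`, `K`-types ★ 58 FILE 1 §0) ⇒ §2.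
* §4 **`innerG_char_cross_eq_zero_of_unramified (hns) (hunr) … (r) (r′) (hsplit₂) (hHom0)`** — JUNCTION LETTERS (★ 73 §U′'s (G3) letters-from-`hunr` block) ⇒ §3.  This is the socket
  (X3′) calls.  NO `IsL2` ∕ `IsEllipticRep` ∕ `IsSupercuspidal` ∕ unitarity ∕ self-`hsplit` letter.
NOT-WILD ∕ TAME twin (`_of_neg_explicit` ∕ `_of_not_wild`, ★ 73 §R∕§NW over ★ 72-NW): a later ED. of the same skeleton once FILE A's ramified datum twin exists.
HONEST LABEL: count-neutral helper; Prop. 12.6.1 (b)-rest stays PRINT of record until a LEAD prices EXT-ROAD v2; h413 OPEN; HC_CM is proved only modulo the 7 printed citations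
(2 remaining named inputs hLiu418 = stmt-HodgeConjecture-24832, h413 = stmt-HodgeConjecture-24833) until rung 0 closes; nothing printed is asserted here.

## References
* [Rogawski1990] J. D. Rogawski, *Automorphic Representations of Unitary Groups in Three Variables*, Ann. of Math. Stud. 123 (1990): §12.6 p. 187 (`Tr π′(f_π) = ⟨χ_{π′}, χ_π⟩_e`),
  Prop. 12.6.1 (b) p. 188.
* [SchneiderStuhler1997] P. Schneider, U. Stuhler, *Representation theory and sheaves on the Bruhat–Tits building*, Publ. Math. IHÉS 85 (1997): §III.4 Thm. III.4.16, Thm. III.4.16 ff.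
* [Kottwitz1988] R. E. Kottwitz, *Tamagawa numbers*, Ann. of Math. 127 (1988): §2 Theorem 2.
* [BernsteinZelevinsky1976] I. N. Bernstein, A. V. Zelevinsky, *Representations of the group GL(n, F) where F is a non-archimedean local field*, Russian Math. Surveys 31 (1976): §2.1–§2.4.
* [BruhatTits1972] F. Bruhat, J. Tits, *Groupes réductifs sur un corps local I*, Publ. Math. IHÉS 41 (1972): §10.
-/

set_option autoImplicit false

set_option linter.dupNamespace false

noncomputable section

open NumberField IsDedekindDomain MeasureTheory Filter Topology
open scoped Matrix MatrixGroups Pointwise Valued WithZero ComplexConjugate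
open Literature.NumberTheory.Rogawski1990 Literature.NumberTheory.Rogawski1990.Ch12Sec5
open Literature.NumberTheory.Automorphic Literature.NumberTheory.Automorphic.UnitaryGroup Literature.NumberTheory.Automorphic.UnitaryLatticeTree
open Literature.NumberTheory.Automorphic.HermitianLattice
open Literature.NumberTheory.GaloisRepresentations
open Literature.Combinatorics.SimpleGraph Literature.Combinatorics.SimpleGraph.OrientedIncidence

namespace Summit.HodgeConjecture.HodgeConjecture.Cruxes.H413.F0P3cStCharTSEPCrossNormZeroUnr
open Summit.HodgeConjecture.HodgeConjecture.Cruxes.H413 Summit.HodgeConjecture.HodgeConjecture.Cruxes.H413.F0P3cStCharTSTorusDefs Summit.HodgeConjecture.HodgeConjecture.Cruxes.H413.F0P3cStCharTSEPNormOneUnr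
open Summit.HodgeConjecture.HodgeConjecture.Cruxes.H413.F0P3cStCharTSK1UnrPseudoCoeffWitness
open Summit.HodgeConjecture.HodgeConjecture.Cruxes.H413.F0P3cStCharTSEPTraceOneAtDatum
open Summit.HodgeConjecture.HodgeConjecture.Cruxes.H413.F0P3cStCharTSTreeOrbitDataGqs

section Head

variable (L : Type) [Field L] [NumberField L] [IsCMField L] (v : HeightOneSpectrum (𝓞 ↥(maximalRealSubfield L)))

/-! ## §1 CROSS-NORM-ZERO in row 58's 3-TERM letters, modulo the pseudo-coefficient head `hpc3` (twin of ★ 59-F `innerG_char_self_eq_one_of_isPseudoCoeff_epThree`) -/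

/-- **CROSS-NORM-ZERO @ UNR, 3-TERM letters — `⟨χ_{[r′]}, χ_{[r]}⟩_e = 0` MODULO the pseudo-coefficient head.**  For the base edge `d₁` with stabilisers `P₀ P₂ P₁` (`hP₀ hP₂ hP₁`), the local
representations `τ₀ τ₂ τ₁` of `r` (coercion laws `hτρᵢ`), the `K`-type pieces `f₀ f₂ f₁` (★ 42 letters), an irreducible smooth `r` with `r.ρ.fixedPoints (U x₀) ≠ ⊥`,
`hpc3 : 𝔇.IsPseudoCoeff [r] (μ(P₀)⁻¹ f₀ + μ(P₂)⁻¹ f₂ − μ(P₁)⁻¹ f₁)` (row 58 S2a's conclusion, token for token), a second irreducible smooth `r′` such that every smooth extension of `r` by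
`r′` splits (`hsplit₂`) and `Hom_G(r, r′) = 0` (`hHom0`): `𝔇.innerG (𝔇.char [r′]) (𝔇.char [r]) = 0`.  Proof: ★ 59-F §1's orbit-data repackaging VERBATIM (`ι₀ := Bool`, `ι₁ := Unit`,
`Fintype.sum_bool`, `Fintype.sum_unique`), then FILE A §4. [cite: Rogawski1990, §12.6 p. 187] [cite: SchneiderStuhler1997, §III.4] [cite: Kottwitz1988, §2] -/
theorem innerG_char_cross_eq_zero_of_isPseudoCoeff_epThree
    (hns : ∀ w : PlacesOver L v, IsCMField.complexConj L • w.1 = w.1)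
    (w : PlacesOver L v) (hw : IsCMField.complexConj L • w.1 = w.1) {ϖ : (w.1.adicCompletion L)} (hd : UnramifiedLocalConjDatum (galAdicCompletionMap (L := L) (IsCMField.complexConj L) hw) ϖ)
    (eA : (Gqs L v) ≃ₜ* ↥(unitaryGroupOfForm (galAdicCompletionMap (L := L) (IsCMField.complexConj L) hw) ((StdForm.antidiagonal 3).over (w.1.adicCompletion L))))
    {a : (Gqs L v) →* ((latticeGraph (galAdicCompletionMap (L := L) (IsCMField.complexConj L) hw) ϖ ((StdForm.antidiagonal 3).over (w.1.adicCompletion L))) ≃g (latticeGraph (galAdicCompletionMap (L := L) (IsCMField.complexConj L) hw) ϖ ((StdForm.antidiagonal 3).over (w.1.adicCompletion L))))} (ha : ∀ g, a g = latticeGraphIso (galAdicCompletionMap (L := L) (IsCMField.complexConj L) hw) ϖ ((StdForm.antidiagonal 3).over (w.1.adicCompletion L)) (eA g))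
    [MeasurableSpace (Gqs L v)] [BorelSpace (Gqs L v)]
    [∀ γ : Gqs L v, MeasurableSpace (Gqs L v ⧸ Subgroup.centralizer ({γ} : Set (Gqs L v)))] [MeasurableSpace (Gqs L v ⧸ Subgroup.center (Gqs L v))]
    {H : Type} [Group H] [TopologicalSpace H] [IsTopologicalGroup H] [MeasurableSpace H]
    (νQv : Measure (Gqs L v)) [νQv.IsHaarMeasure] [νQv.IsMulRightInvariant]
    -- the §12.5 datum and ★ PCT-OUT's letters
    (𝔇 : EllipticData (Gqs L v) H) (hμG : 𝔇.μG = νQv)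
    (hreg : ∀ γ : Gqs L v, γ ∈ 𝔇.regG ↔ IsRegularElt (γ.val : GL (Fin 3) (UnitaryGroup.LocalRing L v)))
    (hM1 : ∀ π : IrrClass (Gqs L v), Measurable (𝔇.char π) ∧ LocallyIntegrable (𝔇.char π) 𝔇.μG ∧
      (∀ x ∈ 𝔇.regG, ∀ᶠ y in 𝓝 x, 𝔇.char π y = 𝔇.char π x) ∧
      ∀ φ : Gqs L v → ℂ, IsLocSmooth φ → π.smoothTrace 𝔇.μG φ = ∫ x, φ x * 𝔇.char π x ∂𝔇.μG)
    (hWIF : 𝔇.WeylIntegrationFormula) (hC1 : 𝔇.EllCartanSubset) (hC2 : 𝔇.EllCartanAE) (hC3 : 𝔇.NonEllCartanAE) (hL2 : 𝔇.L2CharOnTorusAll)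
    (τ : Orientation (latticeGraph (galAdicCompletionMap (L := L) (IsCMField.complexConj L) hw) ϖ ((StdForm.antidiagonal 3).over (w.1.adicCompletion L)))) (hτ : ∀ d, τ.tail d < τ.head d)
    {e : ℕ} {U : {M : Submodule 𝒪[(w.1.adicCompletion L)] (Fin 3 → (w.1.adicCompletion L)) // IsVertex (galAdicCompletionMap (L := L) (IsCMField.complexConj L) hw) ϖ ((StdForm.antidiagonal 3).over (w.1.adicCompletion L)) M} → Subgroup (Gqs L v)}
    (hU : ∀ x g, g ∈ U x ↔ mapGL ((eA g : ↥(unitaryGroupOfForm (galAdicCompletionMap (L := L) (IsCMField.complexConj L) hw) ((StdForm.antidiagonal 3).over (w.1.adicCompletion L)))) : GL (Fin 3) (w.1.adicCompletion L)) x.1 = x.1 ∧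
      x.1.map ((Matrix.toLin' ((((eA g : ↥(unitaryGroupOfForm (galAdicCompletionMap (L := L) (IsCMField.complexConj L) hw) ((StdForm.antidiagonal 3).over (w.1.adicCompletion L)))) : GL (Fin 3) (w.1.adicCompletion L)) : Matrix (Fin 3) (Fin 3) (w.1.adicCompletion L)) - 1)).restrictScalars 𝒪[(w.1.adicCompletion L)]) ≤ scaleLattice (ϖ ^ (e + 1)) x.1)
    -- the base edge and its stabilisers (★ 48-datum ∕ row 58 letters)
    (d₁ : (latticeGraph (galAdicCompletionMap (L := L) (IsCMField.complexConj L) hw) ϖ ((StdForm.antidiagonal 3).over (w.1.adicCompletion L))).edgeSet) (P₀ P₂ P₁ : Subgroup (Gqs L v))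
    (hP₀ : ∀ g, g ∈ P₀ ↔ a g (τ.head d₁) = τ.head d₁) (hP₂ : ∀ g, g ∈ P₂ ↔ a g (τ.tail d₁) = τ.tail d₁) (hP₁ : ∀ g, g ∈ P₁ ↔ (a g).mapEdgeSet d₁ = d₁)
    (r : SmoothIrrep (Gqs L v)) (he : ∃ x₀ : {M : Submodule 𝒪[(w.1.adicCompletion L)] (Fin 3 → (w.1.adicCompletion L)) // IsVertex (galAdicCompletionMap (L := L) (IsCMField.complexConj L) hw) ϖ ((StdForm.antidiagonal 3).over (w.1.adicCompletion L)) M}, r.ρ.fixedPoints (U x₀) ≠ ⊥)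
    -- the three local representations and their `K`-type pieces (★ 48-datum ∕ row 58 letters)
    (τ₀ : Representation ℂ ↥P₀ ↥(r.ρ.fixedPoints (U (τ.head d₁))))
    (hτρ₀ : ∀ (p : ↥P₀) (x : ↥(r.ρ.fixedPoints (U (τ.head d₁)))), ((τ₀ p x : ↥(r.ρ.fixedPoints (U (τ.head d₁)))) : r.V) = r.ρ (p : (Gqs L v)) (x : r.V))
    (τ₂ : Representation ℂ ↥P₂ ↥(r.ρ.fixedPoints (U (τ.tail d₁))))
    (hτρ₂ : ∀ (p : ↥P₂) (x : ↥(r.ρ.fixedPoints (U (τ.tail d₁)))), ((τ₂ p x : ↥(r.ρ.fixedPoints (U (τ.tail d₁)))) : r.V) = r.ρ (p : (Gqs L v)) (x : r.V))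
    (τ₁ : Representation ℂ ↥P₁ ↥(r.ρ.fixedPoints (U (τ.head d₁) ⊔ U (τ.tail d₁))))
    (hτρ₁ : ∀ (p : ↥P₁) (x : ↥(r.ρ.fixedPoints (U (τ.head d₁) ⊔ U (τ.tail d₁)))), ((τ₁ p x : ↥(r.ρ.fixedPoints (U (τ.head d₁) ⊔ U (τ.tail d₁)))) : r.V) = r.ρ (p : (Gqs L v)) (x : r.V))
    {f₀ f₂ f₁ : (Gqs L v) → ℂ}
    (hfP₀ : ∀ (g : (Gqs L v)) (hg : g ∈ P₀), f₀ g = Representation.character τ₀ ⟨g, hg⟩⁻¹) (hf0₀ : ∀ g ∉ P₀, f₀ g = 0)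
    (hfP₂ : ∀ (g : (Gqs L v)) (hg : g ∈ P₂), f₂ g = Representation.character τ₂ ⟨g, hg⟩⁻¹) (hf0₂ : ∀ g ∉ P₂, f₂ g = 0)
    (hfP₁ : ∀ (g : (Gqs L v)) (hg : g ∈ P₁), f₁ g = Representation.character τ₁ ⟨g, hg⟩⁻¹) (hf0₁ : ∀ g ∉ P₁, f₁ g = 0)
    -- row 58's witnessed head S2a: the 3-term EP function IS a pseudo-coefficient of `σ = [r]`
    (hpc3 : 𝔇.IsPseudoCoeff (IrrClass.mk r)
      ((((νQv.real (P₀ : Set (Gqs L v)))⁻¹ : ℂ)) • f₀ + (((νQv.real (P₂ : Set (Gqs L v)))⁻¹ : ℂ)) • f₂ - (((νQv.real (P₁ : Set (Gqs L v)))⁻¹ : ℂ)) • f₁))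
    -- the CROSS letters: a second irreducible smooth `r′`; every SMOOTH extension of `r.ρ` BY `r′.ρ` splits (★ (J′)'s text at `V := r.ρ`, `W := r′.ρ`); `Hom_G(r, r′) = 0`
    (r' : SmoothIrrep (Gqs L v))
    (hsplit₂ : ∀ (E : Type) [AddCommGroup E] [Module ℂ E] (ρE : Representation ℂ (Gqs L v) E), ρE.IsSmooth →
      ∀ (i : r'.ρ.IntertwiningMap ρE) (p : ρE.IntertwiningMap r.ρ), Function.Injective i → LinearMap.ker p.toLinearMap = LinearMap.range i.toLinearMap →
        Function.Surjective p → ∃ s : r.ρ.IntertwiningMap ρE, p.comp s = Representation.IntertwiningMap.id r.ρ)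
    (hHom0 : Subsingleton (r.ρ.IntertwiningMap r'.ρ)) :
    𝔇.innerG (𝔇.char (IrrClass.mk r')) (𝔇.char (IrrClass.mk r)) = 0 := by
  classical
  obtain ⟨x₀, hx₀⟩ := he
  -- the orbit data based at `d₁` (★ TreeOrbitDataGqs)
  obtain ⟨idx₀, tr₀, hidx₀, hidx₀a, htr₀⟩ := exists_vertexOrbitData_gqs L v w hw hd eA ha τ hτ d₁
  obtain ⟨tr₁, htr₁⟩ := exists_edgeOrbitData_gqs L v w hw hd eA ha τ hτ d₁
  -- the Bool-indexed vertex families built from `(P₀, τ₀, f₀ ; P₂, τ₂, f₂)` and the Unit-indexed edge family `(P₁, τ₁, f₁)`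
  let σ₀ : ∀ b : Bool, Representation ℂ ↥(cond b P₀ P₂) ↥(r.ρ.fixedPoints (U (cond b (τ.head d₁) (τ.tail d₁)))) := fun b =>
    match b with
    | true => τ₀
    | false => τ₂
  have hP : ∀ (b : Bool) (g : Gqs L v), g ∈ cond b P₀ P₂ ↔ a g (cond b (τ.head d₁) (τ.tail d₁)) = cond b (τ.head d₁) (τ.tail d₁) := fun b => by
    cases b
    · exact hP₂
    · exact hP₀
  have hσ₀ : ∀ (b : Bool) (p : ↥(cond b P₀ P₂)) (x : ↥(r.ρ.fixedPoints (U (cond b (τ.head d₁) (τ.tail d₁))))),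
      ((σ₀ b p x : ↥(r.ρ.fixedPoints (U (cond b (τ.head d₁) (τ.tail d₁))))) : r.V) = r.ρ (p : Gqs L v) (x : r.V) := fun b => by
    cases b
    · exact hτρ₂
    · exact hτρ₀
  have hfP : ∀ (b : Bool) (g : Gqs L v) (hg : g ∈ cond b P₀ P₂), cond b f₀ f₂ g = (σ₀ b).character ⟨g, hg⟩⁻¹ := fun b => by
    cases b
    · exact hfP₂
    · exact hfP₀
  have hf0 : ∀ (b : Bool), ∀ g ∉ cond b P₀ P₂, cond b f₀ f₂ g = 0 := fun b => by
    cases b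
    · exact hf0₂
    · exact hf0₀
  -- the two-family EP function of these families is the 3-term `f`
  have hf : ((∑ b : Bool, ((νQv.real (cond b P₀ P₂ : Set (Gqs L v)) : ℂ))⁻¹ • cond b f₀ f₂) -
      ∑ _u : Unit, ((νQv.real (P₁ : Set (Gqs L v)) : ℂ))⁻¹ • f₁) =
      (((νQv.real (P₀ : Set (Gqs L v)))⁻¹ : ℂ)) • f₀ + (((νQv.real (P₂ : Set (Gqs L v)))⁻¹ : ℂ)) • f₂ - (((νQv.real (P₁ : Set (Gqs L v)))⁻¹ : ℂ)) • f₁ := by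
    rw [Fintype.sum_bool, Fintype.sum_unique]
    rfl
  have hpc : 𝔇.IsPseudoCoeff (IrrClass.mk r) ((∑ b : Bool, ((νQv.real (cond b P₀ P₂ : Set (Gqs L v)) : ℂ))⁻¹ • cond b f₀ f₂) -
      ∑ _u : Unit, ((νQv.real (P₁ : Set (Gqs L v)) : ℂ))⁻¹ • f₁) := by
    rw [hf]; exact hpc3
  exact F0P3cStCharTSEPTracePairAtDatum.innerG_char_eq_zero_of_forall_extension_split_of_isPseudoCoeff_epTwoFamilies L v hns w hw hd eA ha νQv 𝔇 hμG hreg hM1 hWIF hC1 hC2 hC3 hL2 τ hτ hU r hx₀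
    (fun b => cond b (τ.head d₁) (τ.tail d₁)) idx₀ tr₀ hidx₀ hidx₀a htr₀ (fun b => cond b P₀ P₂) hP σ₀ hσ₀
    (fun _ : Unit => d₁) (fun _ => ()) tr₁ (fun _ => rfl) (fun _ _ => rfl) (fun d => htr₁ d) (fun _ => P₁) (fun _ => hP₁) (fun _ => τ₁) (fun _ => hτρ₁)
    (f₀ := fun b => cond b f₀ f₂) hfP hf0 (f₁ := fun _ => f₁) (fun _ => hfP₁) (fun _ => hf0₁) hpc r' hsplit₂ hHom0

/-! ## §2 `hpc3 := ★ S2a` (row 58 FILE 1 `isPseudoCoeff_epFunction_of_unramified_explicit`) — twin of ★ 59-F ED. 2 `innerG_char_self_eq_one_of_unramified_explicit` -/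

open F0P3cStCharTSTorusDefs in   -- `hyperbolicSet` (the `hE` letter, S2a's binder verbatim)
/-- **CROSS-NORM-ZERO @ UNR, (G3)-EXPLICIT with the pieces given — `⟨χ_{[r′]}, χ_{[r]}⟩_e = 0`.**  §1 with its ONE row-58 binder discharged: `hpc3 := ★ S2a
isPseudoCoeff_epFunction_of_unramified_explicit … (IrrClass.mk r) rfl`.  Binders = S2a's VERBATIM (the (G3)-EXPLICIT block with `heA`, the §12.5 datum with `mQv hcanQ horb hreg hE hM1`,
the level family with `hUo hUc hEo hEc`, the APARTMENT base edge `d₁` pinned by `hd₁`, the stabilisers, `r` with `he`, the three finite-dimensionality instances, the `K`-type letters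
`τᵢ hτρᵢ hτᵢ fᵢ hfPᵢ hf0ᵢ`) + ★ PCT-OUT's `hWIF hC1 hC2 hC3 hL2` + the cross letters `(r′) (hsplit₂) (hHom0)`.  NO `IsL2` ∕ `IsEllipticRep` ∕ self-`hsplit` letter.
[cite: Rogawski1990, §12.6 p. 187] [cite: SchneiderStuhler1997, §III.4] [cite: Kottwitz1988, §2] -/
theorem innerG_char_cross_eq_zero_of_unramified_explicit_pieces
    (hns : ∀ w : PlacesOver L v, IsCMField.complexConj L • w.1 = w.1)
    (w : PlacesOver L v) (hw : IsCMField.complexConj L • w.1 = w.1) {ϖ : w.1.adicCompletion L} (hd : UnramifiedLocalConjDatum (galAdicCompletionMap (L := L) (IsCMField.complexConj L) hw) ϖ)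
    (eA : Gqs L v ≃ₜ* ↥(unitaryGroupOfForm (galAdicCompletionMap (L := L) (IsCMField.complexConj L) hw) ((StdForm.antidiagonal 3).over (w.1.adicCompletion L))))
    (heA : ∀ g : Gqs L v, ((eA g : ↥(unitaryGroupOfForm (galAdicCompletionMap (L := L) (IsCMField.complexConj L) hw) ((StdForm.antidiagonal 3).over (w.1.adicCompletion L)))) : GL (Fin 3) (w.1.adicCompletion L)) = ((localNonsplitEquiv (IsCMField.complexConj L) (qsForm L) (IsCMField.complexConj_ne_one L) w hw g : ↥(unitaryGroupOfForm (galAdicCompletionMap (L := L) (IsCMField.complexConj L) hw) (placeForm (qsForm L) w.1))) : GL (Fin 3) (w.1.adicCompletion L)))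
    [MeasurableSpace (Gqs L v)] [BorelSpace (Gqs L v)]
    [∀ γ : Gqs L v, MeasurableSpace (Gqs L v ⧸ Subgroup.centralizer ({γ} : Set (Gqs L v)))] [∀ γ : Gqs L v, BorelSpace (Gqs L v ⧸ Subgroup.centralizer ({γ} : Set (Gqs L v)))]
    [MeasurableSpace (Gqs L v ⧸ Subgroup.center (Gqs L v))]
    {H : Type} [Group H] [TopologicalSpace H] [IsTopologicalGroup H] [MeasurableSpace H]
    (νQv : Measure (Gqs L v)) [νQv.IsHaarMeasure] [νQv.IsMulRightInvariant] (mQv : OrbitalMeasureFamily (Gqs L v))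
    (hcanQ : mQv.IsCanonical (fun γ => IsRegularElt (γ.val : GL (Fin 3) (UnitaryGroup.LocalRing L v))) νQv)
    (𝔇 : EllipticData (Gqs L v) H) (hμG : 𝔇.μG = νQv) (horb : 𝔇.orb = mQv)
    (hreg : ∀ γ : Gqs L v, γ ∈ 𝔇.regG ↔ IsRegularElt (γ.val : GL (Fin 3) (UnitaryGroup.LocalRing L v)))
    (hE : ∀ γ : Gqs L v, γ ∈ 𝔇.ellG ↔ IsRegularElt (γ.val : GL (Fin 3) (UnitaryGroup.LocalRing L v)) ∧ γ ∉ hyperbolicSet L v)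
    (hM1 : ∀ π : IrrClass (Gqs L v), Measurable (𝔇.char π) ∧ LocallyIntegrable (𝔇.char π) 𝔇.μG ∧ (∀ x ∈ 𝔇.regG, ∀ᶠ y in 𝓝 x, 𝔇.char π y = 𝔇.char π x) ∧
      ∀ φ : Gqs L v → ℂ, IsLocSmooth φ → π.smoothTrace 𝔇.μG φ = ∫ x, φ x * 𝔇.char π x ∂𝔇.μG)
    (hWIF : 𝔇.WeylIntegrationFormula) (hC1 : 𝔇.EllCartanSubset) (hC2 : 𝔇.EllCartanAE) (hC3 : 𝔇.NonEllCartanAE) (hL2 : 𝔇.L2CharOnTorusAll)   -- ★ PCT-OUT's extra letters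
    {a : (Gqs L v) →* ((latticeGraph (galAdicCompletionMap (L := L) (IsCMField.complexConj L) hw) ϖ ((StdForm.antidiagonal 3).over (w.1.adicCompletion L))) ≃g (latticeGraph (galAdicCompletionMap (L := L) (IsCMField.complexConj L) hw) ϖ ((StdForm.antidiagonal 3).over (w.1.adicCompletion L))))} (ha : ∀ g, a g = latticeGraphIso (galAdicCompletionMap (L := L) (IsCMField.complexConj L) hw) ϖ ((StdForm.antidiagonal 3).over (w.1.adicCompletion L)) (eA g))
    (τ : Orientation (latticeGraph (galAdicCompletionMap (L := L) (IsCMField.complexConj L) hw) ϖ ((StdForm.antidiagonal 3).over (w.1.adicCompletion L)))) (hτ : ∀ d, τ.tail d < τ.head d)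
    {e : ℕ} {U : {M : Submodule 𝒪[(w.1.adicCompletion L)] (Fin 3 → (w.1.adicCompletion L)) // IsVertex (galAdicCompletionMap (L := L) (IsCMField.complexConj L) hw) ϖ ((StdForm.antidiagonal 3).over (w.1.adicCompletion L)) M} → Subgroup (Gqs L v)}
    (hU : ∀ x g, g ∈ U x ↔ mapGL ((eA g : ↥(unitaryGroupOfForm (galAdicCompletionMap (L := L) (IsCMField.complexConj L) hw) ((StdForm.antidiagonal 3).over (w.1.adicCompletion L)))) : GL (Fin 3) (w.1.adicCompletion L)) x.1 = x.1 ∧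
    x.1.map ((Matrix.toLin' ((((eA g : ↥(unitaryGroupOfForm (galAdicCompletionMap (L := L) (IsCMField.complexConj L) hw) ((StdForm.antidiagonal 3).over (w.1.adicCompletion L)))) : GL (Fin 3) (w.1.adicCompletion L)) : Matrix (Fin 3) (Fin 3) (w.1.adicCompletion L)) - 1)).restrictScalars 𝒪[(w.1.adicCompletion L)]) ≤ scaleLattice (ϖ ^ (e + 1)) x.1)
    (hUo : ∀ x, IsOpen (U x : Set (Gqs L v))) (hUc : ∀ x, IsCompact (U x : Set (Gqs L v)))
    (hEo : ∀ d : (latticeGraph (galAdicCompletionMap (L := L) (IsCMField.complexConj L) hw) ϖ ((StdForm.antidiagonal 3).over (w.1.adicCompletion L))).edgeSet, IsOpen ((U (τ.head d) ⊔ U (τ.tail d) : Subgroup (Gqs L v)) : Set (Gqs L v)))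
    (hEc : ∀ d : (latticeGraph (galAdicCompletionMap (L := L) (IsCMField.complexConj L) hw) ϖ ((StdForm.antidiagonal 3).over (w.1.adicCompletion L))).edgeSet, IsCompact ((U (τ.head d) ⊔ U (τ.tail d) : Subgroup (Gqs L v)) : Set (Gqs L v)))
    {A : ℤ → {M : Submodule 𝒪[(w.1.adicCompletion L)] (Fin 3 → (w.1.adicCompletion L)) // IsVertex (galAdicCompletionMap (L := L) (IsCMField.complexConj L) hw) ϖ ((StdForm.antidiagonal 3).over (w.1.adicCompletion L)) M}} (hA0 : ∀ c : ℤ, (A (2 * c)).1 = latt (Matrix.diagonal ![ϖ ^ c, (1 : w.1.adicCompletion L), ϖ ^ (-c)])) (hA1 : ∀ c : ℤ, (A (2 * c + 1)).1 = latt (Matrix.diagonal ![ϖ ^ (c + 1), (1 : w.1.adicCompletion L), ϖ ^ (-c)]))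
    (d₁ : (latticeGraph (galAdicCompletionMap (L := L) (IsCMField.complexConj L) hw) ϖ ((StdForm.antidiagonal 3).over (w.1.adicCompletion L))).edgeSet) (hd₁ : (d₁ : Sym2 {M : Submodule 𝒪[(w.1.adicCompletion L)] (Fin 3 → (w.1.adicCompletion L)) // IsVertex (galAdicCompletionMap (L := L) (IsCMField.complexConj L) hw) ϖ ((StdForm.antidiagonal 3).over (w.1.adicCompletion L)) M}) = s(A 0, A 1)) (P₀ P₂ P₁ : Subgroup (Gqs L v))
    (hP₀ : ∀ g, g ∈ P₀ ↔ a g (τ.head d₁) = τ.head d₁) (hP₂ : ∀ g, g ∈ P₂ ↔ a g (τ.tail d₁) = τ.tail d₁) (hP₁ : ∀ g, g ∈ P₁ ↔ (a g).mapEdgeSet d₁ = d₁)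
    (r : SmoothIrrep (Gqs L v)) (he : ∃ x₀ : {M : Submodule 𝒪[(w.1.adicCompletion L)] (Fin 3 → (w.1.adicCompletion L)) // IsVertex (galAdicCompletionMap (L := L) (IsCMField.complexConj L) hw) ϖ ((StdForm.antidiagonal 3).over (w.1.adicCompletion L)) M}, r.ρ.fixedPoints (U x₀) ≠ ⊥)
    [FiniteDimensional ℂ ↥(r.ρ.fixedPoints (U (τ.head d₁)))] [FiniteDimensional ℂ ↥(r.ρ.fixedPoints (U (τ.tail d₁)))]
    [FiniteDimensional ℂ ↥(r.ρ.fixedPoints (U (τ.head d₁) ⊔ U (τ.tail d₁)))]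
    (τ₀ : Representation ℂ ↥P₀ ↥(r.ρ.fixedPoints (U (τ.head d₁))))
    (hτρ₀ : ∀ (p : ↥P₀) (x : ↥(r.ρ.fixedPoints (U (τ.head d₁)))), ((τ₀ p x : ↥(r.ρ.fixedPoints (U (τ.head d₁)))) : r.V) = r.ρ (p : (Gqs L v)) (x : r.V))
    (hτ₀ : ∀ p : ↥P₀, (p : (Gqs L v)) ∈ U (τ.head d₁) → τ₀ p = 1)
    (τ₂ : Representation ℂ ↥P₂ ↥(r.ρ.fixedPoints (U (τ.tail d₁))))
    (hτρ₂ : ∀ (p : ↥P₂) (x : ↥(r.ρ.fixedPoints (U (τ.tail d₁)))), ((τ₂ p x : ↥(r.ρ.fixedPoints (U (τ.tail d₁)))) : r.V) = r.ρ (p : (Gqs L v)) (x : r.V))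
    (hτ₂ : ∀ p : ↥P₂, (p : (Gqs L v)) ∈ U (τ.tail d₁) → τ₂ p = 1)
    (τ₁ : Representation ℂ ↥P₁ ↥(r.ρ.fixedPoints (U (τ.head d₁) ⊔ U (τ.tail d₁))))
    (hτρ₁ : ∀ (p : ↥P₁) (x : ↥(r.ρ.fixedPoints (U (τ.head d₁) ⊔ U (τ.tail d₁)))), ((τ₁ p x : ↥(r.ρ.fixedPoints (U (τ.head d₁) ⊔ U (τ.tail d₁)))) : r.V) = r.ρ (p : (Gqs L v)) (x : r.V))
    (hτ₁ : ∀ p : ↥P₁, (p : (Gqs L v)) ∈ U (τ.head d₁) ⊔ U (τ.tail d₁) → τ₁ p = 1)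
    {f₀ f₂ f₁ : (Gqs L v) → ℂ}
    (hfP₀ : ∀ (g : (Gqs L v)) (hg : g ∈ P₀), f₀ g = Representation.character τ₀ ⟨g, hg⟩⁻¹) (hf0₀ : ∀ g ∉ P₀, f₀ g = 0)
    (hfP₂ : ∀ (g : (Gqs L v)) (hg : g ∈ P₂), f₂ g = Representation.character τ₂ ⟨g, hg⟩⁻¹) (hf0₂ : ∀ g ∉ P₂, f₂ g = 0)
    (hfP₁ : ∀ (g : (Gqs L v)) (hg : g ∈ P₁), f₁ g = Representation.character τ₁ ⟨g, hg⟩⁻¹) (hf0₁ : ∀ g ∉ P₁, f₁ g = 0)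
    -- the CROSS letters: a second irreducible smooth `r′`; every SMOOTH extension of `r.ρ` BY `r′.ρ` splits (★ (J′)'s text at `V := r.ρ`, `W := r′.ρ`); `Hom_G(r, r′) = 0`
    (r' : SmoothIrrep (Gqs L v))
    (hsplit₂ : ∀ (E : Type) [AddCommGroup E] [Module ℂ E] (ρE : Representation ℂ (Gqs L v) E), ρE.IsSmooth →
      ∀ (i : r'.ρ.IntertwiningMap ρE) (p : ρE.IntertwiningMap r.ρ), Function.Injective i → LinearMap.ker p.toLinearMap = LinearMap.range i.toLinearMap →
        Function.Surjective p → ∃ s : r.ρ.IntertwiningMap ρE, p.comp s = Representation.IntertwiningMap.id r.ρ)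
    (hHom0 : Subsingleton (r.ρ.IntertwiningMap r'.ρ)) :
    𝔇.innerG (𝔇.char (IrrClass.mk r')) (𝔇.char (IrrClass.mk r)) = 0 :=
  innerG_char_cross_eq_zero_of_isPseudoCoeff_epThree L v hns w hw hd eA ha νQv 𝔇 hμG hreg hM1 hWIF hC1 hC2 hC3 hL2 τ hτ hU d₁ P₀ P₂ P₁ hP₀ hP₂ hP₁ r he
    τ₀ hτρ₀ τ₂ hτρ₂ τ₁ hτρ₁ hfP₀ hf0₀ hfP₂ hf0₂ hfP₁ hf0₁
    (F0P3cStCharTSK1UnrPseudoCoeffWitness.isPseudoCoeff_epFunction_of_unramified_explicit L v hns w hw hd eA heA νQv mQv hcanQ 𝔇 hμG horb hreg hE hM1 ha τ hτ hU hUo hUc hEo hEc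
      hA0 hA1 d₁ hd₁ P₀ P₂ P₁ hP₀ hP₂ hP₁ r he τ₀ hτρ₀ hτ₀ τ₂ hτρ₂ hτ₂ τ₁ hτρ₁ hτ₁ hfP₀ hf0₀ hfP₂ hf0₂ hfP₁ hf0₁ (IrrClass.mk r) rfl) r' hsplit₂ hHom0

/-! ## §3 (G3)-EXPLICIT letters, the level ∕ tree ∕ base-edge ∕ `K`-type choices made ONCE from `r` — twin of ★ 73 §U -/

set_option maxHeartbeats 1600000 in
-- instance-term unification on the CM local carriers and the vertex subtype (as ★ 73 §U ∕ ★ 58 S2b ∕ ★ 41g-H)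
/-- **§3 CROSS-NORM-ZERO @ UNR, (G3)-EXPLICIT letters.**  At a non-split UNRAMIFIED place `v` with the one-place model `(w hw ϖ hd eA heA)`, at a §12.5 datum `𝔇` with the junction pins
`hμG horb hreg hE hM1` and ★ PCT-OUT's `hWIF hC1 hC2 hC3 hL2`: **for irreducible smooth `r`, `r′` of `U(Φ₃)(L⁺_v)` such that every SMOOTH extension of `r` by `r′` splits (`hsplit₂`) and
`Hom_G(r, r′) = 0` (`hHom0`), `⟨χ_⟦r′⟧, χ_⟦r⟧⟩_e = 0`.**  Proof = ★ 73 §U's construction VERBATIM (level `e` by ★ 43 below the open stabiliser of a non-zero vector of `r` at the apartment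
vertex `A 0` ★ 39γ, tree letters ★ 41g-H §2, invariant orientation, base edge `A 0 — A 1`, stabilisers through `eA`, `K`-types ★ 58 FILE 1 §0, pieces by `dite`) then §2.
NO class letter (`IsL2` ∕ `IsEllipticRep` ∕ l.d.s. membership ∕ unitarity). [cite: Rogawski1990, §12.6 p. 187; Prop. 12.6.1 (b) p. 188] [cite: SchneiderStuhler1997, Thm. III.4.16, §III.4]
[cite: Kottwitz1988, §2] [cite: BruhatTits1972, §10] -/
theorem innerG_char_cross_eq_zero_of_unramified_explicit
    (hns : ∀ w : PlacesOver L v, IsCMField.complexConj L • w.1 = w.1)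
    (w : PlacesOver L v) (hw : IsCMField.complexConj L • w.1 = w.1) {ϖ : w.1.adicCompletion L} (hd : UnramifiedLocalConjDatum (galAdicCompletionMap (L := L) (IsCMField.complexConj L) hw) ϖ)
    (eA : Gqs L v ≃ₜ* ↥(unitaryGroupOfForm (galAdicCompletionMap (L := L) (IsCMField.complexConj L) hw) ((StdForm.antidiagonal 3).over (w.1.adicCompletion L))))
    (heA : ∀ g : Gqs L v, ((eA g : ↥(unitaryGroupOfForm (galAdicCompletionMap (L := L) (IsCMField.complexConj L) hw) ((StdForm.antidiagonal 3).over (w.1.adicCompletion L)))) : GL (Fin 3) (w.1.adicCompletion L)) = ((localNonsplitEquiv (IsCMField.complexConj L) (qsForm L) (IsCMField.complexConj_ne_one L) w hw g : ↥(unitaryGroupOfForm (galAdicCompletionMap (L := L) (IsCMField.complexConj L) hw) (placeForm (qsForm L) w.1))) : GL (Fin 3) (w.1.adicCompletion L)))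
    [MeasurableSpace (Gqs L v)] [BorelSpace (Gqs L v)]
    [∀ γ : Gqs L v, MeasurableSpace (Gqs L v ⧸ Subgroup.centralizer ({γ} : Set (Gqs L v)))] [∀ γ : Gqs L v, BorelSpace (Gqs L v ⧸ Subgroup.centralizer ({γ} : Set (Gqs L v)))]
    [MeasurableSpace (Gqs L v ⧸ Subgroup.center (Gqs L v))]
    {H : Type} [Group H] [TopologicalSpace H] [IsTopologicalGroup H] [MeasurableSpace H]
    (νQv : Measure (Gqs L v)) [νQv.IsHaarMeasure] [νQv.IsMulRightInvariant] (mQv : OrbitalMeasureFamily (Gqs L v))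
    (hcanQ : mQv.IsCanonical (fun γ => IsRegularElt (γ.val : GL (Fin 3) (UnitaryGroup.LocalRing L v))) νQv)
    (𝔇 : EllipticData (Gqs L v) H) (hμG : 𝔇.μG = νQv) (horb : 𝔇.orb = mQv)
    (hreg : ∀ γ : Gqs L v, γ ∈ 𝔇.regG ↔ IsRegularElt (γ.val : GL (Fin 3) (UnitaryGroup.LocalRing L v)))
    (hE : ∀ γ : Gqs L v, γ ∈ 𝔇.ellG ↔ IsRegularElt (γ.val : GL (Fin 3) (UnitaryGroup.LocalRing L v)) ∧ γ ∉ hyperbolicSet L v)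
    (hM1 : ∀ π : IrrClass (Gqs L v), Measurable (𝔇.char π) ∧ LocallyIntegrable (𝔇.char π) 𝔇.μG ∧ (∀ x ∈ 𝔇.regG, ∀ᶠ y in 𝓝 x, 𝔇.char π y = 𝔇.char π x) ∧
      ∀ φ : Gqs L v → ℂ, IsLocSmooth φ → π.smoothTrace 𝔇.μG φ = ∫ x, φ x * 𝔇.char π x ∂𝔇.μG)
    (hWIF : 𝔇.WeylIntegrationFormula) (hC1 : 𝔇.EllCartanSubset) (hC2 : 𝔇.EllCartanAE) (hC3 : 𝔇.NonEllCartanAE) (hL2 : 𝔇.L2CharOnTorusAll)   -- ★ PCT-OUT's extra letters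
    (r : SmoothIrrep (Gqs L v))
    -- the CROSS letters: a second irreducible smooth `r′`; every SMOOTH extension of `r.ρ` BY `r′.ρ` splits (★ (J′)'s text at `V := r.ρ`, `W := r′.ρ`); `Hom_G(r, r′) = 0`
    (r' : SmoothIrrep (Gqs L v))
    (hsplit₂ : ∀ (E : Type) [AddCommGroup E] [Module ℂ E] (ρE : Representation ℂ (Gqs L v) E), ρE.IsSmooth →
      ∀ (i : r'.ρ.IntertwiningMap ρE) (p : ρE.IntertwiningMap r.ρ), Function.Injective i → LinearMap.ker p.toLinearMap = LinearMap.range i.toLinearMap →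
        Function.Surjective p → ∃ s : r.ρ.IntertwiningMap ρE, p.comp s = Representation.IntertwiningMap.id r.ρ)
    (hHom0 : Subsingleton (r.ρ.IntertwiningMap r'.ρ)) :
    𝔇.innerG (𝔇.char (IrrClass.mk r')) (𝔇.char (IrrClass.mk r)) = 0 := by
  classical
  haveI : r.ρ.IsIrreducible := r.isIrreducible
  haveI : NonarchimedeanGroup (Gqs L v) :=
    nonarchimedeanGroup_unitaryGroupOfForm_local (E := L) (c := IsCMField.complexConj L) (N := 3) (v := v) (J' := (adelicForm L 3 (qsForm L)).map (adeleToLocal L v))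
  haveI := compactSpace_integer_adicCompletion L w.1
  have hadm : r.ρ.IsAdmissible := F0P3cStCharTSScTracePackage.isAdmissible_smoothIrrep L v hns r
  have hϖ0 : ϖ ≠ 0 := CartanUnique.uniformizer_ne_zero hd.vϖ
  have hϖ1 : Valued.v ϖ < 1 := by rw [hd.vϖ, ← WithZero.exp_zero]; exact WithZero.exp_lt_exp.2 (by norm_num)
  -- (E) a non-zero vector, its open stabiliser, the base vertex `A 0` with a frame `g₀`, and the level `e` (★ 43)
  haveI : Nontrivial r.V := Representation.IsIrreducible.nontrivial r.ρ
  obtain ⟨v₁, hv₁⟩ := exists_ne (0 : r.V)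
  have hSo : IsOpen ((r.ρ.stabilizerSubgroup v₁ : Subgroup (Gqs L v)) : Set (Gqs L v)) := r.isSmooth v₁
  obtain ⟨A, hA0, hA1⟩ := exists_apartmentEnum (σ := (galAdicCompletionMap (L := L) (IsCMField.complexConj L) hw)) hd
  obtain ⟨g₀, hg₀⟩ := exists_coe_eq_latt (galAdicCompletionMap (L := L) (IsCMField.complexConj L) hw) ϖ ((StdForm.antidiagonal 3).over (w.1.adicCompletion L)) (A 0)
  have hWo : IsOpen ((eA.symm : ↥(unitaryGroupOfForm (galAdicCompletionMap (L := L) (IsCMField.complexConj L) hw) ((StdForm.antidiagonal 3).over (w.1.adicCompletion L))) → Gqs L v) ⁻¹' ((r.ρ.stabilizerSubgroup v₁ : Subgroup (Gqs L v)) : Set (Gqs L v))) :=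
    hSo.preimage eA.symm.continuous
  have hW1 : (1 : ↥(unitaryGroupOfForm (galAdicCompletionMap (L := L) (IsCMField.complexConj L) hw) ((StdForm.antidiagonal 3).over (w.1.adicCompletion L)))) ∈ (eA.symm : ↥(unitaryGroupOfForm (galAdicCompletionMap (L := L) (IsCMField.complexConj L) hw) ((StdForm.antidiagonal 3).over (w.1.adicCompletion L))) → Gqs L v) ⁻¹' ((r.ρ.stabilizerSubgroup v₁ : Subgroup (Gqs L v)) : Set (Gqs L v)) := by
    show eA.symm 1 ∈ ((r.ρ.stabilizerSubgroup v₁ : Subgroup (Gqs L v)) : Set (Gqs L v))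
    rw [map_one]
    exact (r.ρ.stabilizerSubgroup v₁).one_mem
  obtain ⟨e', he', h43⟩ := exists_forall_map_sub_one_latt_le_scaleLattice_pow_imp_mem_unitary (galAdicCompletionMap (L := L) (IsCMField.complexConj L) hw) ((StdForm.antidiagonal 3).over (w.1.adicCompletion L)) hϖ0 hϖ1 g₀ hWo hW1 1
  obtain ⟨e, rfl⟩ : ∃ e : ℕ, e' = e + 1 := ⟨e' - 1, by omega⟩
  -- (T) the tree letters at level `e` (★ 41g-H §2)
  obtain ⟨a, U, ha, hU⟩ := F0P3cStCharTSCharacterEllipticUniform.exists_actionHom_unitaryLevelFamily L v w hw eA e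
  have hUo : ∀ x, IsOpen (U x : Set (Gqs L v)) := fun x => F0P3cStCharTSCharacterEllipticUniform.isOpen_coe_unitaryLevel_gqs hU hd x
  have hUc : ∀ x, IsCompact (U x : Set (Gqs L v)) := fun x => F0P3cStCharTSCharacterEllipticUniform.isCompact_coe_unitaryLevel_gqs hU hd x
  have he : ∃ x₀ : {M : Submodule 𝒪[(w.1.adicCompletion L)] (Fin 3 → (w.1.adicCompletion L)) // IsVertex (galAdicCompletionMap (L := L) (IsCMField.complexConj L) hw) ϖ ((StdForm.antidiagonal 3).over (w.1.adicCompletion L)) M}, r.ρ.fixedPoints (U x₀) ≠ ⊥ := by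
    refine ⟨A 0, (Submodule.ne_bot_iff _).2 ⟨v₁, ?_, hv₁⟩⟩
    rw [Representation.mem_fixedPoints]
    intro g hg
    obtain ⟨-, hle⟩ := (hU (A 0) g).1 hg
    rw [hg₀] at hle
    have hmem : eA.symm (eA g) ∈ ((r.ρ.stabilizerSubgroup v₁ : Subgroup (Gqs L v)) : Set (Gqs L v)) := h43 (eA g) hle
    rw [eA.symm_apply_apply] at hmem
    exact hmem
  -- (O) orientation, edge groups, base edge, stabilisers
  obtain ⟨τ, hτ⟩ := exists_orientation_latticeGraph (galAdicCompletionMap (L := L) (IsCMField.complexConj L) hw) ϖ ((StdForm.antidiagonal 3).over (w.1.adicCompletion L))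
  have hfixE : ∀ (g : Gqs L v) (d : (latticeGraph (galAdicCompletionMap (L := L) (IsCMField.complexConj L) hw) ϖ ((StdForm.antidiagonal 3).over (w.1.adicCompletion L))).edgeSet), (a g).mapEdgeSet d = d ↔ a g (τ.head d) = τ.head d ∧ a g (τ.tail d) = τ.tail d := fun g d => by
    have h := head_mapEdgeSet_latticeGraphIso (galAdicCompletionMap (L := L) (IsCMField.complexConj L) hw) ϖ ((StdForm.antidiagonal 3).over (w.1.adicCompletion L)) hτ (eA g) d
    rw [← ha] at h
    exact iso_mapEdgeSet_eq_iff τ (a g) d h.1 h.2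
  have hEo : ∀ d : (latticeGraph (galAdicCompletionMap (L := L) (IsCMField.complexConj L) hw) ϖ ((StdForm.antidiagonal 3).over (w.1.adicCompletion L))).edgeSet, IsOpen ((U (τ.head d) ⊔ U (τ.tail d) : Subgroup (Gqs L v)) : Set (Gqs L v)) := fun d =>
    F0P3cStCharTSCharacterEllipticUniform.isOpen_coe_sup_unitaryLevel_gqs hU hd _ _
  have hEc : ∀ d : (latticeGraph (galAdicCompletionMap (L := L) (IsCMField.complexConj L) hw) ϖ ((StdForm.antidiagonal 3).over (w.1.adicCompletion L))).edgeSet, IsCompact ((U (τ.head d) ⊔ U (τ.tail d) : Subgroup (Gqs L v)) : Set (Gqs L v)) := fun d =>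
    F0P3cStCharTSCharacterEllipticUniform.isCompact_coe_sup_unitaryLevel_gqs_of_adj hU hd (τ.adj_head_tail d)
  have hadj : (latticeGraph (galAdicCompletionMap (L := L) (IsCMField.complexConj L) hw) ϖ ((StdForm.antidiagonal 3).over (w.1.adicCompletion L))).Adj (A 0) (A 1) := by
    simpa using latticeGraph_adj_apartmentEnum_succ hd A hA0 hA1 0
  obtain ⟨d₁, hd₁⟩ : ∃ d₁ : (latticeGraph (galAdicCompletionMap (L := L) (IsCMField.complexConj L) hw) ϖ ((StdForm.antidiagonal 3).over (w.1.adicCompletion L))).edgeSet, (d₁ : Sym2 {M : Submodule 𝒪[(w.1.adicCompletion L)] (Fin 3 → (w.1.adicCompletion L)) // IsVertex (galAdicCompletionMap (L := L) (IsCMField.complexConj L) hw) ϖ ((StdForm.antidiagonal 3).over (w.1.adicCompletion L)) M}) = s(A 0, A 1) := ⟨⟨s(A 0, A 1), (SimpleGraph.mem_edgeSet _).2 hadj⟩, rfl⟩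
  have hstab : ∀ x : {M : Submodule 𝒪[(w.1.adicCompletion L)] (Fin 3 → (w.1.adicCompletion L)) // IsVertex (galAdicCompletionMap (L := L) (IsCMField.complexConj L) hw) ϖ ((StdForm.antidiagonal 3).over (w.1.adicCompletion L)) M}, ∃ P : Subgroup (Gqs L v), ∀ g, g ∈ P ↔ a g x = x := fun x => by
    obtain ⟨Q, hQ⟩ := exists_stabilizerSubgroup (galAdicCompletionMap (L := L) (IsCMField.complexConj L) hw) ϖ ((StdForm.antidiagonal 3).over (w.1.adicCompletion L)) x
    exact ⟨Q.comap eA.toMonoidHom, fun g => by rw [F0P3cStCharTSCharacterEllipticUniform.mem_comap_iff', hQ, ha]⟩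
  obtain ⟨P₀, hP₀⟩ := hstab (τ.head d₁)
  obtain ⟨P₂, hP₂⟩ := hstab (τ.tail d₁)
  obtain ⟨P₁, hP₁⟩ : ∃ P₁ : Subgroup (Gqs L v), ∀ g, g ∈ P₁ ↔ (a g).mapEdgeSet d₁ = d₁ :=
    ⟨P₀ ⊓ P₂, fun g => by rw [Subgroup.mem_inf, hP₀, hP₂, hfixE]⟩
  -- stabilisers inside normalisers (★ (U3)), for the `K`-types
  have hPU₀ : P₀ ≤ Subgroup.normalizer ((U (τ.head d₁) : Subgroup (Gqs L v)) : Set (Gqs L v)) := fun g hg =>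
    F0P3cStCharTSCharacterEllipticUniform.mem_normalizer_unitaryLevel_gqs_of_apply_eq ha hU ((hP₀ g).1 hg)
  have hPU₂ : P₂ ≤ Subgroup.normalizer ((U (τ.tail d₁) : Subgroup (Gqs L v)) : Set (Gqs L v)) := fun g hg =>
    F0P3cStCharTSCharacterEllipticUniform.mem_normalizer_unitaryLevel_gqs_of_apply_eq ha hU ((hP₂ g).1 hg)
  have hPU₁ : P₁ ≤ Subgroup.normalizer ((U (τ.head d₁) ⊔ U (τ.tail d₁) : Subgroup (Gqs L v)) : Set (Gqs L v)) := fun g hg =>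
    Subgroup.normalizer_inf_normalizer_le_normalizer_sup (U (τ.head d₁)) (U (τ.tail d₁))
      (Subgroup.mem_inf.2 ⟨F0P3cStCharTSCharacterEllipticUniform.mem_normalizer_unitaryLevel_gqs_of_apply_eq ha hU ((hfixE g d₁).1 ((hP₁ g).1 hg)).1,
        F0P3cStCharTSCharacterEllipticUniform.mem_normalizer_unitaryLevel_gqs_of_apply_eq ha hU ((hfixE g d₁).1 ((hP₁ g).1 hg)).2⟩)
  -- finite-dimensional fixed spaces (admissibility), the three `K`-type restrictions (§0), the three pieces
  haveI : FiniteDimensional ℂ ↥(r.ρ.fixedPoints (U (τ.head d₁))) := hadm.finite_fixedPoints ⟨U (τ.head d₁), hUo _⟩ (hUc _)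
  haveI : FiniteDimensional ℂ ↥(r.ρ.fixedPoints (U (τ.tail d₁))) := hadm.finite_fixedPoints ⟨U (τ.tail d₁), hUo _⟩ (hUc _)
  haveI : FiniteDimensional ℂ ↥(r.ρ.fixedPoints (U (τ.head d₁) ⊔ U (τ.tail d₁))) := hadm.finite_fixedPoints ⟨U (τ.head d₁) ⊔ U (τ.tail d₁), hEo d₁⟩ (hEc d₁)
  obtain ⟨τ₀, hτρ₀, hτ₀⟩ := exists_restrictRep_fixedPoints r.ρ P₀ (U (τ.head d₁)) hPU₀
  obtain ⟨τ₂, hτρ₂, hτ₂⟩ := exists_restrictRep_fixedPoints r.ρ P₂ (U (τ.tail d₁)) hPU₂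
  obtain ⟨τ₁, hτρ₁, hτ₁⟩ := exists_restrictRep_fixedPoints r.ρ P₁ (U (τ.head d₁) ⊔ U (τ.tail d₁)) hPU₁
  obtain ⟨f₀, hfP₀, hf0₀⟩ : ∃ f₀ : Gqs L v → ℂ, (∀ (g : Gqs L v) (hg : g ∈ P₀), f₀ g = Representation.character τ₀ ⟨g, hg⟩⁻¹) ∧ ∀ g ∉ P₀, f₀ g = 0 :=
    ⟨fun g => if hg : g ∈ P₀ then Representation.character τ₀ ⟨g, hg⟩⁻¹ else 0, fun g hg => dif_pos hg, fun g hg => dif_neg hg⟩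
  obtain ⟨f₂, hfP₂, hf0₂⟩ : ∃ f₂ : Gqs L v → ℂ, (∀ (g : Gqs L v) (hg : g ∈ P₂), f₂ g = Representation.character τ₂ ⟨g, hg⟩⁻¹) ∧ ∀ g ∉ P₂, f₂ g = 0 :=
    ⟨fun g => if hg : g ∈ P₂ then Representation.character τ₂ ⟨g, hg⟩⁻¹ else 0, fun g hg => dif_pos hg, fun g hg => dif_neg hg⟩
  obtain ⟨f₁, hfP₁, hf0₁⟩ : ∃ f₁ : Gqs L v → ℂ, (∀ (g : Gqs L v) (hg : g ∈ P₁), f₁ g = Representation.character τ₁ ⟨g, hg⟩⁻¹) ∧ ∀ g ∉ P₁, f₁ g = 0 :=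
    ⟨fun g => if hg : g ∈ P₁ then Representation.character τ₁ ⟨g, hg⟩⁻¹ else 0, fun g hg => dif_pos hg, fun g hg => dif_neg hg⟩
  exact innerG_char_cross_eq_zero_of_unramified_explicit_pieces L v hns w hw hd eA heA νQv mQv hcanQ 𝔇 hμG horb hreg hE hM1 hWIF hC1 hC2 hC3 hL2 ha τ hτ hU hUo hUc hEo hEc hA0 hA1 d₁ hd₁
    P₀ P₂ P₁ hP₀ hP₂ hP₁ r he τ₀ hτρ₀ hτ₀ τ₂ hτρ₂ hτ₂ τ₁ hτρ₁ hτ₁ hfP₀ hf0₀ hfP₂ hf0₂ hfP₁ hf0₁ r' hsplit₂ hHom0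

/-! ## §4 JUNCTION LETTERS (§3 over the ★ (G3) letters-from-`hunr` block) — twin of ★ 73 §U′; the socket (X3′) calls -/

/-- **§4 CROSS-NORM-ZERO @ UNR, junction letters.**  At a non-split place `v` UNRAMIFIED in `L` (`hunr`), at the §12.5 datum with the junction pins and ★ PCT-OUT's letters: for
irreducible smooth `r`, `r′` with `hsplit₂` (every smooth extension of `r` by `r′` splits) and `hHom0` (`Hom_G(r, r′) = 0`), `⟨χ_⟦r′⟧, χ_⟦r⟧⟩_e = 0` — the (G3)-EXPLICIT letters exist
because `v` is unramified (★ `unramifiedLocalConjDatum_adicCompletion`) and `G_v ≃ₜ* U(antidiag(1,1,1))(L_w)` (★ `localNonsplitEquiv` re-read on `Φ₃`; pattern of ★ 58 S1 ∕ ★ 73 §U′).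
EXT-ROAD v2 (S-A) contrapositive: `⟨χ_⟦r′⟧, χ_⟦r⟧⟩_e ≠ 0 ⇒ Hom_G(r, r′) ≠ 0 ∨` some smooth extension of `r` by `r′` does not split.
[cite: Rogawski1990, §12.6 p. 187; Prop. 12.6.1 (b) p. 188] [cite: SchneiderStuhler1997, §III.4] [cite: Kottwitz1988, §2] -/
theorem innerG_char_cross_eq_zero_of_unramified
    (hns : ∀ w : PlacesOver L v, IsCMField.complexConj L • w.1 = w.1) (hunr : Algebra.IsUnramifiedIn (𝓞 L) v.asIdeal)
    [MeasurableSpace (Gqs L v)] [BorelSpace (Gqs L v)]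
    [∀ γ : Gqs L v, MeasurableSpace (Gqs L v ⧸ Subgroup.centralizer ({γ} : Set (Gqs L v)))] [∀ γ : Gqs L v, BorelSpace (Gqs L v ⧸ Subgroup.centralizer ({γ} : Set (Gqs L v)))]
    [MeasurableSpace (Gqs L v ⧸ Subgroup.center (Gqs L v))]
    {H : Type} [Group H] [TopologicalSpace H] [IsTopologicalGroup H] [MeasurableSpace H]
    (νQv : Measure (Gqs L v)) [νQv.IsHaarMeasure] [νQv.IsMulRightInvariant] (mQv : OrbitalMeasureFamily (Gqs L v))
    (hcanQ : mQv.IsCanonical (fun γ => IsRegularElt (γ.val : GL (Fin 3) (UnitaryGroup.LocalRing L v))) νQv)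
    (𝔇 : EllipticData (Gqs L v) H) (hμG : 𝔇.μG = νQv) (horb : 𝔇.orb = mQv)
    (hreg : ∀ γ : Gqs L v, γ ∈ 𝔇.regG ↔ IsRegularElt (γ.val : GL (Fin 3) (UnitaryGroup.LocalRing L v)))
    (hE : ∀ γ : Gqs L v, γ ∈ 𝔇.ellG ↔ IsRegularElt (γ.val : GL (Fin 3) (UnitaryGroup.LocalRing L v)) ∧ γ ∉ hyperbolicSet L v)
    (hM1 : ∀ π : IrrClass (Gqs L v), Measurable (𝔇.char π) ∧ LocallyIntegrable (𝔇.char π) 𝔇.μG ∧ (∀ x ∈ 𝔇.regG, ∀ᶠ y in 𝓝 x, 𝔇.char π y = 𝔇.char π x) ∧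
      ∀ φ : Gqs L v → ℂ, IsLocSmooth φ → π.smoothTrace 𝔇.μG φ = ∫ x, φ x * 𝔇.char π x ∂𝔇.μG)
    (hWIF : 𝔇.WeylIntegrationFormula) (hC1 : 𝔇.EllCartanSubset) (hC2 : 𝔇.EllCartanAE) (hC3 : 𝔇.NonEllCartanAE) (hL2 : 𝔇.L2CharOnTorusAll)   -- ★ PCT-OUT's extra letters
    (r : SmoothIrrep (Gqs L v))
    -- the CROSS letters: a second irreducible smooth `r′`; every SMOOTH extension of `r.ρ` BY `r′.ρ` splits (★ (J′)'s text at `V := r.ρ`, `W := r′.ρ`); `Hom_G(r, r′) = 0`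
    (r' : SmoothIrrep (Gqs L v))
    (hsplit₂ : ∀ (E : Type) [AddCommGroup E] [Module ℂ E] (ρE : Representation ℂ (Gqs L v) E), ρE.IsSmooth →
      ∀ (i : r'.ρ.IntertwiningMap ρE) (p : ρE.IntertwiningMap r.ρ), Function.Injective i → LinearMap.ker p.toLinearMap = LinearMap.range i.toLinearMap →
        Function.Surjective p → ∃ s : r.ρ.IntertwiningMap ρE, p.comp s = Representation.IntertwiningMap.id r.ρ)
    (hHom0 : Subsingleton (r.ρ.IntertwiningMap r'.ρ)) :
    𝔇.innerG (𝔇.char (IrrClass.mk r')) (𝔇.char (IrrClass.mk r)) = 0 := by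
  obtain ⟨w⟩ : Nonempty (PlacesOver L v) := inferInstance
  have hw : IsCMField.complexConj L • w.1 = w.1 := hns w
  have hc1 : IsCMField.complexConj L ≠ 1 := IsCMField.complexConj_ne_one L
  -- the unramified datum at `w` (this is where `hunr` is spent)
  obtain ⟨ϖ, hd⟩ := unramifiedLocalConjDatum_adicCompletion (IsCMField.complexConj L) hc1 v w hw hunr
  -- the one-place model re-read on the literal form `Φ₃ = antidiag(1,1,1)` (★ (G3) :189–:196)
  have hJw : placeForm (qsForm L) w.1 = (StdForm.antidiagonal 3).over (w.1.adicCompletion L) := by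
    rw [placeForm, qsForm, antidiagOne_eq_over, StdForm.over_map]
  obtain ⟨eA, heA⟩ : ∃ eA : Gqs L v ≃ₜ* ↥(unitaryGroupOfForm (galAdicCompletionMap (L := L) (IsCMField.complexConj L) hw) ((StdForm.antidiagonal 3).over (w.1.adicCompletion L))),
      ∀ g : Gqs L v, ((eA g : ↥(unitaryGroupOfForm (galAdicCompletionMap (L := L) (IsCMField.complexConj L) hw) ((StdForm.antidiagonal 3).over (w.1.adicCompletion L)))) :
          GL (Fin 3) (w.1.adicCompletion L)) =
        ((localNonsplitEquiv (IsCMField.complexConj L) (qsForm L) hc1 w hw g :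
          ↥(unitaryGroupOfForm (galAdicCompletionMap (L := L) (IsCMField.complexConj L) hw) (placeForm (qsForm L) w.1))) : GL (Fin 3) (w.1.adicCompletion L)) := by
    rw [← hJw]
    exact ⟨localNonsplitEquiv (IsCMField.complexConj L) (qsForm L) hc1 w hw, fun g => rfl⟩
  exact innerG_char_cross_eq_zero_of_unramified_explicit L v hns w hw hd eA heA νQv mQv hcanQ 𝔇 hμG horb hreg hE hM1 hWIF hC1 hC2 hC3 hL2 r r' hsplit₂ hHom0

end Head

end Summit.HodgeConjecture.HodgeConjecture.Cruxes.H413.F0P3cStCharTSEPCrossNormZeroUnr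

end
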